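import Mathlib.Logic.Function.Basic
import Mathlib.Tactic.Common

/-!
# `NearExactIsExact` (stmt-QuantumAdvantage-14043) — three affine equations for a `2`-flat of `𝔽₂⁵`

B2b disprover cell (gen 27); Boolean-vector bookkeeping for THEOREM MM59-W (`Negative.TypeOMM59WindowFourteen`).
HONEST FRAMING: elementary linear algebra over `𝔽₂` on `Fin 5 → Bool`, NOT summit progress.

* `flat_eqs`: for `s, t ∈ 𝔽₂⁵ ∖ {0}`, `s ≠ t`, there are pivots `i ≠ j` and vectors `α, β` such that the
  equations `x_k ⊕ α_k x_i ⊕ β_k x_j = 0` (`k ≠ i, j`; at most three of them) cut out exactly the linear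
  `2`-flat `{0, s, t, s ⊕ t}` (reduced echelon form of the `2 × 5` matrix `(s; t)`);
* small `decide`d Boolean identities used to read off / compare points `a₁ ⊕ us ⊕ vt` of an affine `2`-flat.
Sources: [folklore]. Standard axioms only.
-/

set_option linter.dupNamespace false -- D-0017: single-problem summit ⇒ `QuantumAdvantage.QuantumAdvantage` by design

namespace Summit.QuantumAdvantage.QuantumAdvantage.Theorems.NearExactIsExact.Negative.FlatEqsFive

/-! ### Reduced echelon form -/

/-- Solving one coordinate equation. [folklore] -/
theorem la_solve : ∀ xk sk tk sj xi xj : Bool,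
    ((xk ^^ ((sk ^^ (tk && sj)) && xi)) ^^ (tk && xj)) = false →
      xk = ((xi && sk) ^^ (((xi && sj) ^^ xj) && tk)) := by
  decide

/-- The pivot coordinate `i`. [folklore] -/
theorem la_i : ∀ xi w : Bool, xi = ((xi && true) ^^ (w && false)) := by decide

/-- The pivot coordinate `j`. [folklore] -/
theorem la_j : ∀ xi sj xj : Bool, xj = ((xi && sj) ^^ (((xi && sj) ^^ xj) && true)) := by decide

/-- The coordinate equations are `⊕`-linear. [folklore] -/
theorem la_lin : ∀ a a' p b b' r d d' : Bool,
    (((a ^^ a') ^^ (p && (b ^^ b'))) ^^ (r && (d ^^ d'))) =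
      (((a ^^ (p && b)) ^^ (r && d)) ^^ ((a' ^^ (p && b')) ^^ (r && d'))) := by
  decide

/-- **Linear algebra.** For `s, t ∈ 𝔽₂⁵ ∖ {0}`, `s ≠ t`, there are pivots `i ≠ j` and vectors `α, β` such that
the three (of five; two are vacuous) equations `x_k ⊕ α_k x_i ⊕ β_k x_j = 0` (`k ≠ i, j`) cut out exactly
`{0, s, t, s ⊕ t}`. [folklore] -/
theorem flat_eqs (s t : Fin 5 → Bool) (hs : s ≠ fun _ => false) (ht : t ≠ fun _ => false) (hst : s ≠ t) :
    ∃ i j : Fin 5, i ≠ j ∧ ∃ α β : Fin 5 → Bool, ∀ x : Fin 5 → Bool,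
      (∀ k, k ≠ i → k ≠ j → ((x k ^^ (α k && x i)) ^^ (β k && x j)) = false) ↔
        (x = (fun _ => false) ∨ x = s ∨ x = t ∨ x = fun k => (s k ^^ t k)) := by
  obtain ⟨i, hi⟩ := Function.ne_iff.mp hs
  have hsi : s i = true := by simpa using hi
  set t' : Fin 5 → Bool := fun k => t k ^^ (t i && s k) with ht'
  have ht'i : t' i = false := by
    simp only [ht', hsi, Bool.and_true, Bool.xor_self]
  have htk : ∀ k, t k = (t' k ^^ (t i && s k)) := fun k => by
    simp only [ht']
    cases t k <;> cases (t i && s k) <;> rfl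
  have ht'ne : t' ≠ fun _ => false := by
    intro h0
    have h0k : ∀ k, t' k = false := fun k => congr_fun h0 k
    cases hti : t i
    · exact ht (funext fun k => by rw [htk k, h0k k, hti]; rfl)
    · exact hst (funext fun k => by rw [htk k, h0k k, hti]; simp)
  obtain ⟨j, hj⟩ := Function.ne_iff.mp ht'ne
  have ht'j : t' j = true := by simpa using hj
  have hij : i ≠ j := fun h => by
    rw [h] at ht'i
    rw [ht'i] at ht'j
    exact Bool.false_ne_true ht'j
  refine ⟨i, j, hij, fun k => s k ^^ (t' k && s j), t', fun x => ⟨fun H => ?_, fun H => ?_⟩⟩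
  · -- solved form of the equations
    have key : ∀ k, x k = ((x i && s k) ^^ (((x i && s j) ^^ x j) && t' k)) := by
      intro k
      by_cases hki : k = i
      · rw [hki, hsi, ht'i]
        exact la_i _ _
      · by_cases hkj : k = j
        · rw [hkj, ht'j]
          exact la_j _ _ _
        · exact la_solve _ _ _ _ _ _ (H k hki hkj)
    cases hxi : x i <;> cases hxj : x j
    · left
      funext k
      rw [key k, hxi, hxj]
      simp
    · right
      cases hti : t i
      · right; left
        funext k
        rw [key k, hxi, hxj, htk k, hti]
        simp
      · right; right
        funext k
        rw [key k, hxi, hxj, htk k, hti]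
        cases s k <;> cases t' k <;> simp
    · cases hsj : s j
      · right; left
        funext k
        rw [key k, hxi, hxj, hsj]
        simp
      · cases hti : t i
        · right; right; right
          funext k
          rw [key k, hxi, hxj, hsj, htk k, hti]
          cases s k <;> cases t' k <;> decide
        · right; right; left
          funext k
          rw [key k, hxi, hxj, hsj, htk k, hti]
          cases s k <;> cases t' k <;> decide
    · cases hsj : s j
      · cases hti : t i
        · right; right; right
          funext k
          rw [key k, hxi, hxj, hsj, htk k, hti]
          cases s k <;> cases t' k <;> decide
        · right; right; left
          funext k
          rw [key k, hxi, hxj, hsj, htk k, hti]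
          cases s k <;> cases t' k <;> decide
      · right; left
        funext k
        rw [key k, hxi, hxj, hsj]
        simp
  · -- the four points satisfy the equations
    intro k hki hkj
    have Ls : ((s k ^^ ((s k ^^ (t' k && s j)) && s i)) ^^ (t' k && s j)) = false := by
      rw [hsi]
      cases s k <;> cases t' k <;> cases s j <;> decide
    have Lt : ((t k ^^ ((s k ^^ (t' k && s j)) && t i)) ^^ (t' k && t j)) = false := by
      rw [htk k, htk j, ht'j]
      cases t' k <;> cases t i <;> cases s k <;> cases s j <;> decide
    rcases H with rfl | rfl | rfl | rfl
    · simp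
    · exact Ls
    · exact Lt
    · show (((s k ^^ t k) ^^ ((s k ^^ (t' k && s j)) && (s i ^^ t i))) ^^ (t' k && (s j ^^ t j))) = false
      rw [la_lin, Ls, Lt]
      rfl

/-! ### Points of an affine `2`-flat -/

/-- Cancelling in `𝔽₂`. [folklore] -/
theorem xor_cancel : ∀ a b c : Bool, (a ^^ b) = (a ^^ c) → b = c := by decide

/-- Solving in `𝔽₂`. [folklore] -/
theorem xor_solve : ∀ a b c : Bool, (a ^^ b) = c → a = (b ^^ c) := by decide

/-- `a ⊕ b = 0 ⇒ a = b`. [folklore] -/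
theorem xor_eq_false : ∀ a b : Bool, (a ^^ b) = false → a = b := by decide

/-- Independence tests. [folklore] -/
theorem in_ft : ∀ a b : Bool, ((false && a) ^^ (true && b)) = false → b = false := by decide

/-- Independence tests. [folklore] -/
theorem in_tf : ∀ a b : Bool, ((true && a) ^^ (false && b)) = false → a = false := by decide

/-- Independence tests. [folklore] -/
theorem in_tt : ∀ a b : Bool, ((true && a) ^^ (true && b)) = false → a = b := by decide

/-- Difference of two combinations. [folklore] -/
theorem in_diff : ∀ u v u' v' a b : Bool, ((u && a) ^^ (v && b)) = ((u' && a) ^^ (v' && b)) →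
    (((u ^^ u') && a) ^^ ((v ^^ v') && b)) = false := by decide

/-- Reading a point of the flat. [folklore] -/
theorem pt_ff : ∀ a b c : Bool, ((a ^^ ((false && b) ^^ (false && c))) ^^ a) = false := by decide

/-- Reading a point of the flat. [folklore] -/
theorem pt_tf : ∀ a b c : Bool, ((a ^^ ((true && b) ^^ (false && c))) ^^ a) = b := by decide

/-- Reading a point of the flat. [folklore] -/
theorem pt_ft : ∀ a b c : Bool, ((a ^^ ((false && b) ^^ (true && c))) ^^ a) = c := by decide

/-- Reading a point of the flat. [folklore] -/
theorem pt_tt : ∀ a b c : Bool, ((a ^^ ((true && b) ^^ (true && c))) ^^ a) = (b ^^ c) := by decide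

end Summit.QuantumAdvantage.QuantumAdvantage.Theorems.NearExactIsExact.Negative.FlatEqsFive
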